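import Summits.CriticalPhenomena.PercolationContinuityZ3.Theorems.Transplant.FKDoubleFanLetterCone
import HarnessLib

/-!
# Double fans `K₂ ∨ P_{m+1}`: the INVARIANT BLOCK DECOMPOSITION `ℝ⁵ = V₃ ⊕ V₂` of the hat space, and the polyhedral letter cone
# `C3` of the `∧²V₃`-block — the `∧²V₃`-part of the far cross-apex Rayleigh difference is non-negative for EVERY word

Helper file (`--supports stmt-CriticalPhenomena-4575`), FK sub-lane `prim-bschramm-fk-3` (gen 44); builds on p205010 (kernel theorem, internal
audit signed; external expert review pending).  Pure real algebra: no measures, no named facts, no sorries; standard axioms.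
Memo `bschramm/prim-bschramm-fk-3/FAR-CROSS-XIX.md` §1.

STRUCTURE.  In hat coordinates `(u,x,y,z,v)` the three letter generators `P_a = diag(0,0,1,0,1)`, `P_b = diag(0,0,0,1,1)` and the detach
operator `D = f₁ ⊗ α + f₂ ⊗ φ` (`f₁ = e_u+e_y+e_z`, `f₂ = e_x+e_v`, `α = −(1+p)e_u^* + e_y^* + e_z^*`, `φ = −p e_x^* + e_v^*`, `p = 1−q`) all
preserve the two coordinate subspaces **`V₃ = ⟨e_u, e_y, e_z⟩`** and **`V₂ = ⟨e_x, e_v⟩`** (the algebra they generate with `1` has dimension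
`13 = 9 + 4`, not `25`).  Hence the ten Plücker coordinates split into THREE blocks that are separately invariant under all six operators
`T_D, W_D, T_a, W_a, T_b, W_b` (so under the letters `∧²E_r, ∧²AC_x, ∧²BC_y`):
`∧²V₃ = ⟨e_uy, e_uz, e_yz⟩` (3), `V₃ ⊗ V₂ = ⟨e_ux, e_uv, e_xy, e_yv, e_xz, e_zv⟩` (6), `∧²V₂ = ⟨e_xv⟩` (1)
(**`opTD_blk33`**, **`opTD_xv`**; the spoke operators are diagonal).  On `V₂` the `a`-spoke and the `b`-spoke coincide (`diag(1−t, 1)`); on `V₃`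
the detach operator has RANK ONE (`f₁ ⊗ α`), so `∧²D|_{∧²V₃} = 0` and `T_D|_{∧²V₃} = q·Π_F` is `q` times the projection onto the plane
`F = f₁ ∧ V₃ = {uy − uz + yz = 0}` along the line `ℝ·(−1, 1, 1+p) = ∧²(ker α)`.
THE CONE.  **`C3 q`**: `0 ≤ β_uy`, `β_uz ≤ 0`, `β_uy − β_uz + β_yz ≤ 0`, `(2−q)β_uz − β_yz ≥ 0` — a polyhedral cone with the four rays
`−e_yz`, `e_uy − e_yz`, `−e_uz − (1+p)e_yz`, `p e_uy − e_uz − (1+p)e_yz`.  It contains every input `u ∧ P_a u` (**`C3.input`**) and is a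
LETTER CONE for `0 ≤ q ≤ 1` (**`isLetterCone_C3`**; exact transfer identities: `ℓ₁∘T_D = qℓ₁ + ℓ₃`, `ℓ₂∘T_D = qℓ₂ + ℓ₃`, `ℓ₃∘T_D = 0`,
`ℓ₄∘T_D = qℓ₄` for the four facet functionals, and diagonal laws for the spokes), hence contains the pair bivector of every double-fan word
(**`C3.midWord`**).  CONSEQUENCE (**`pairH33_target_nonneg`**, **`pairH33_crossFar_nonneg`**): the `∧²V₃`-part
`p²[(1+p)·β_uz·γ_uz − β_yz·γ_yz]` of the pairing with any target `s ∧ P_b s` (`s` with non-negative masses) is `≥ 0` — one of the three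
block parts of the far cross-apex Rayleigh difference is settled for all middles (the `∧²V₂`-part `p·β_xv·γ_xv` is trivially `≥ 0`,
**`pairH22_target_nonneg`**; the mixed `V₃⊗V₂`-part carries the whole difficulty and is NOT sign-definite, memo §1c).
[cite: Grimmett2006, §3.9 eq. (3.94) (pp. 63–64)] [folklore]
-/

noncomputable section

namespace Summit.CriticalPhenomena.PercolationContinuityZ3.Theorems

namespace FK

namespace ThreeApex

/-! ### Block invariance of the polarised detach operator -/

/-- The `∧²V₃`-block `(uy, uz, yz)` of `T_D β` depends only on the `∧²V₃`-block of `β`. [folklore] -/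
theorem opTD_blk33 (q : ℝ) (β : Biv) :
    (opTD q β).uy = -(1 - q) * β.uy + β.uz - β.yz ∧ (opTD q β).uz = β.uy - (1 - q) * β.uz + β.yz ∧
      (opTD q β).yz = (2 - q) * β.uy - (2 - q) * β.uz + 2 * β.yz := by
  simp only [opTD]; exact ⟨trivial, trivial, trivial⟩

/-- The `∧²V₂`-block: `(T_D β)_xv = q·β_xv`. [folklore] -/
theorem opTD_xv (q : ℝ) (β : Biv) : (opTD q β).xv = q * β.xv := by
  simp only [opTD]

/-- The `V₃ ⊗ V₂`-block `(ux, uv, xy, yv, xz, zv)` of `T_D β` depends only on the `V₃ ⊗ V₂`-block of `β` (Sylvester form `D₃ M + M D₂ᵀ`). [folklore] -/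
theorem opTD_blk32 (q : ℝ) (β : Biv) :
    (opTD q β).ux = -(1 + 2 * (1 - q)) * β.ux + β.uv - β.xy - β.xz ∧ (opTD q β).uv = -(1 - q) * β.ux - (1 - q) * β.uv + β.yv + β.zv ∧
      (opTD q β).xy = (2 - q) * β.ux + q * β.xy + β.xz - β.yv ∧ (opTD q β).xz = (2 - q) * β.ux + β.xy + q * β.xz - β.zv ∧
        (opTD q β).yv = -(2 - q) * β.uv + (1 - q) * β.xy + 2 * β.yv + β.zv ∧
          (opTD q β).zv = -(2 - q) * β.uv + (1 - q) * β.xz + β.yv + 2 * β.zv := by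
  simp only [opTD]; exact ⟨trivial, trivial, trivial, trivial, trivial, trivial⟩

/-- `W_D` vanishes on the `∧²V₃`-block (`∧²` of the rank-one operator `D|_{V₃}`) and on the `∧²V₂`-block. [folklore] -/
theorem opWD_blk33 (q : ℝ) (β : Biv) : (opWD q β).uy = 0 ∧ (opWD q β).uz = 0 ∧ (opWD q β).yz = 0 ∧ (opWD q β).xv = 0 := by
  simp only [opWD]; exact ⟨trivial, trivial, trivial, trivial⟩

/-! ### The polyhedral cone `C3` of the `∧²V₃`-block -/

/-- **The cone `C3`**: the four facet inequalities of the `∧²V₃`-block satisfied by every double-fan word image. [folklore] -/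
@[folklore] structure C3 (q : ℝ) (β : Biv) : Prop where
  /-- `ℓ₁ = β_uy ≥ 0` -/
  uy : 0 ≤ β.uy
  /-- `ℓ₂ = −β_uz ≥ 0` -/
  uz : β.uz ≤ 0
  /-- `ℓ₃ = −β_uy + β_uz − β_yz ≥ 0` (the block lies on the negative side of the plane `F = f₁ ∧ V₃`) -/
  fac : β.uy - β.uz + β.yz ≤ 0
  /-- `ℓ₄ = (1+p)β_uz − β_yz ≥ 0` (the target functional) -/
  tgt : 0 ≤ (2 - q) * β.uz - β.yz

namespace C3

variable {q : ℝ} {β γ : Biv}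

/-- On `C3`, `β_yz ≤ 0` (for `q ≤ 2`). [folklore] -/
theorem yz_nonpos (hq : q ≤ 2) (h : C3 q β) : β.yz ≤ 0 := by
  have := h.tgt; have := h.uz; nlinarith

/-- The zero bivector lies in `C3`. [folklore] -/
theorem zero : C3 q (⟨0, 0, 0, 0, 0, 0, 0, 0, 0, 0⟩ : Biv) :=
  ⟨le_refl _, le_refl _, by simp, by simp⟩

/-- `C3` is closed under sums. [folklore] -/
theorem add (hβ : C3 q β) (hγ : C3 q γ) : C3 q (Biv.add β γ) := by
  obtain ⟨a1, a2, a3, a4⟩ := hβ; obtain ⟨b1, b2, b3, b4⟩ := hγ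
  refine ⟨?_, ?_, ?_, ?_⟩ <;> simp only [Biv.add] <;> nlinarith

/-- `C3` is closed under non-negative multiples. [folklore] -/
theorem smul {a : ℝ} (ha : 0 ≤ a) (hβ : C3 q β) : C3 q (Biv.smul a β) := by
  obtain ⟨a1, a2, a3, a4⟩ := hβ
  refine ⟨?_, ?_, ?_, ?_⟩ <;> simp only [Biv.smul]
  · exact mul_nonneg ha a1
  · exact mul_nonpos_of_nonneg_of_nonpos ha a2
  · nlinarith [mul_nonpos_of_nonneg_of_nonpos ha a3]
  · nlinarith [mul_nonneg ha a4]

/-- `C3` is closed under three-term non-negative combinations. [folklore] -/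
theorem lin3 {a b c : ℝ} {δ : Biv} (ha : 0 ≤ a) (hb : 0 ≤ b) (hc : 0 ≤ c) (hβ : C3 q β) (hγ : C3 q γ) (hδ : C3 q δ) :
    C3 q (Biv.lin3 a β b γ c δ) :=
  (hβ.smul ha).add ((hγ.smul hb).add (hδ.smul hc))

/-- **`T_D` maps `C3` into itself** (`0 ≤ q`): `ℓ₁∘T_D = qℓ₁ + ℓ₃`, `ℓ₂∘T_D = qℓ₂ + ℓ₃`, `ℓ₃∘T_D = 0`, `ℓ₄∘T_D = qℓ₄`. [folklore] -/
theorem opTD (hq : 0 ≤ q) (h : C3 q β) : C3 q (opTD q β) := by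
  obtain ⟨a1, a2, a3, a4⟩ := h
  refine ⟨?_, ?_, ?_, ?_⟩ <;> simp only [ThreeApex.opTD]
  · nlinarith [mul_nonneg hq a1]
  · nlinarith [mul_nonpos_of_nonneg_of_nonpos hq a2]
  · nlinarith
  · nlinarith [mul_nonneg hq a4]

/-- `W_D` maps everything to the zero block, which lies in `C3`. [folklore] -/
theorem opWD (β : Biv) : C3 q (opWD q β) := by
  refine ⟨?_, ?_, ?_, ?_⟩ <;> simp [ThreeApex.opWD]

/-- **The rim step preserves `C3`** (`0 ≤ q`, `0 ≤ r ≤ 1`). [folklore] -/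
theorem opE (hq : 0 ≤ q) {r : ℝ} (hr0 : 0 ≤ r) (hr1 : r ≤ 1) (h : C3 q β) : C3 q (opE q r β) := by
  unfold ThreeApex.opE
  exact lin3 (by positivity) (mul_nonneg hr0 (by linarith)) (by positivity) h (h.opTD hq) (opWD β)

/-- **The `a`-spoke preserves `C3`** (`0 ≤ x ≤ 1`, `q ≤ 2`): the block scales by `diag(1−x, (1−x)², 1−x)`. [folklore] -/
theorem opAC (hq : q ≤ 2) {x : ℝ} (hx0 : 0 ≤ x) (hx1 : x ≤ 1) (h : C3 q β) : C3 q (opAC x β) := by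
  obtain ⟨a1, a2, a3, a4⟩ := h
  have h1x : 0 ≤ 1 - x := by linarith
  refine ⟨?_, ?_, ?_, ?_⟩ <;> simp only [ThreeApex.opAC, opTa, opWa, Biv.lin3, Biv.add, Biv.smul]
  · nlinarith [mul_nonneg h1x a1, mul_nonneg hx0 h1x]
  · nlinarith [mul_nonpos_of_nonneg_of_nonpos h1x a2, mul_nonneg hx0 h1x]
  · nlinarith [mul_nonpos_of_nonneg_of_nonpos h1x a3, mul_nonpos_of_nonneg_of_nonpos (mul_nonneg hx0 h1x) a2]
  · nlinarith [mul_nonneg h1x a4, mul_nonpos_of_nonneg_of_nonpos (mul_nonneg (mul_nonneg hx0 h1x) (by linarith : (0:ℝ) ≤ 2 - q)) a2]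

/-- **The `b`-spoke preserves `C3`** (`0 ≤ y ≤ 1`): the block scales by `diag((1−y)², 1−y, 1−y)`. [folklore] -/
theorem opBC {y : ℝ} (hy0 : 0 ≤ y) (hy1 : y ≤ 1) (h : C3 q β) : C3 q (opBC y β) := by
  obtain ⟨a1, a2, a3, a4⟩ := h
  have h1y : 0 ≤ 1 - y := by linarith
  refine ⟨?_, ?_, ?_, ?_⟩ <;> simp only [ThreeApex.opBC, opTb, opWb, Biv.lin3, Biv.add, Biv.smul]
  · nlinarith [mul_nonneg (mul_nonneg h1y h1y) a1]
  · nlinarith [mul_nonpos_of_nonneg_of_nonpos h1y a2, mul_nonneg hy0 h1y]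
  · nlinarith [mul_nonpos_of_nonneg_of_nonpos h1y a3, mul_nonneg (mul_nonneg hy0 h1y) a1]
  · nlinarith [mul_nonneg h1y a4, mul_nonneg hy0 h1y]

/-- **Inputs lie in `C3`**: the block of `u ∧ P_a u` is `(Z₀ŷ, 0, −ŷẑ)` (masses of `u` non-negative). [folklore] -/
theorem input (q : ℝ) {u : V5} (hu : u.Nonneg) : C3 q (wedgeH (conv (edgeAC 0) u) (conv (edgeAC 1) u)) := by
  obtain ⟨h0, hab, hac, hbc, h1⟩ := hu
  refine ⟨?_, ?_, ?_, ?_⟩ <;> simp only [wedgeH, conv, edgeAC, hx, hy, hz, V5.total] <;> nlinarith [mul_nonneg h0 hac, mul_nonneg hbc h0,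
    mul_nonneg hbc hac, mul_nonneg h0 h0]

end C3

/-- **`C3` is a letter cone** (`0 ≤ q ≤ 1`). [folklore] -/
theorem isLetterCone_C3 {q : ℝ} (hq0 : 0 ≤ q) (hq1 : q ≤ 1) : IsLetterCone q {β | C3 q β} where
  zero_mem := C3.zero
  add_mem := fun _ _ hβ hγ => hβ.add hγ
  smul_mem := fun _ _ ha hβ => hβ.smul ha
  rim := fun _ _ hr0 hr1 hβ => hβ.opE hq0 hr0 hr1
  ac := fun _ _ hx0 hx1 hβ => hβ.opAC (by linarith) hx0 hx1
  bc := fun _ _ hy0 hy1 hβ => hβ.opBC hy0 hy1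

/-- **Every double-fan word image lies in `C3`**: the pair bivector after any middle word and last rim step (weights in `[0,1]`, `0 ≤ q ≤ 1`,
input masses non-negative). [folklore] -/
theorem C3.midWord {q : ℝ} (hq0 : 0 ≤ q) (hq1 : q ≤ 1) {mids : List (ℝ × ℝ × ℝ)} (hm : UnitBlocks mids) {rd : ℝ} (hrd0 : 0 ≤ rd)
    (hrd1 : rd ≤ 1) {u : V5} (hu : u.Nonneg) :
    C3 q (wedgeH (rimStep q rd (midWord q mids (conv (edgeAC 0) u))) (rimStep q rd (midWord q mids (conv (edgeAC 1) u)))) :=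
  (isLetterCone_C3 hq0 hq1).wedgeH_rimStep_mem hrd0 hrd1 ((isLetterCone_C3 hq0 hq1).wedgeH_midWord_mem hm (C3.input q hu))

/-! ### The three block parts of the pairing with a target -/

/-- The `∧²V₃`-part of the pairing `pairH`. [folklore] -/
def pairH33 (q : ℝ) (β γ : Biv) : ℝ := (1 - q) ^ 2 * (2 - q) * (β.uy * γ.uy + β.uz * γ.uz) - (1 - q) ^ 2 * (β.yz * γ.yz)

/-- The `V₃ ⊗ V₂`-part of the pairing `pairH`. [folklore] -/
def pairH32 (q : ℝ) (β γ : Biv) : ℝ :=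
  (1 - q) ^ 2 * (2 - q) * (β.ux * γ.ux) - (1 - q) * (2 - q) * β.uv * γ.uv - (1 - q) ^ 2 * (β.xy * γ.xy + β.xz * γ.xz)
    + (1 - q) * (β.yv * γ.yv + β.zv * γ.zv)

/-- The `∧²V₂`-part of the pairing `pairH`. [folklore] -/
def pairH22 (q : ℝ) (β γ : Biv) : ℝ := (1 - q) * (β.xv * γ.xv)

/-- `pairH = pairH33 + pairH32 + pairH22`. [folklore] -/
theorem pairH_eq_blocks (q : ℝ) (β γ : Biv) : pairH q β γ = pairH33 q β γ + pairH32 q β γ + pairH22 q β γ := by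
  simp only [pairH, pairH33, pairH32, pairH22]; ring

/-- The target bivector `(s ∗ BC_0) ∧ (s ∗ BC_1) = s ∧ P_b s`: its `∧²V₃`-block is `(0, Z₀'ẑ', ŷ'ẑ')` and its `xv`-coordinate is `x̂'·|s|`. [folklore] -/
theorem target_blocks (s : V5) :
    (wedgeH (conv s (edgeBC 0)) (conv s (edgeBC 1))).uy = 0 ∧ (wedgeH (conv s (edgeBC 0)) (conv s (edgeBC 1))).uz = s.z0 * hz s ∧
      (wedgeH (conv s (edgeBC 0)) (conv s (edgeBC 1))).yz = hy s * hz s ∧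
        (wedgeH (conv s (edgeBC 0)) (conv s (edgeBC 1))).xv = hx s * s.total := by
  refine ⟨?_, ?_, ?_, ?_⟩ <;> simp only [wedgeH, conv, edgeBC, hx, hy, hz, V5.total] <;> ring

/-- **The `∧²V₃`-part of the pairing of a `C3` bivector with any target is non-negative** (`q ≤ 1`, masses of `s` non-negative):
`p²ẑ'[(1+p)Z₀'β_uz − ŷ'β_yz] = p²ẑ'[Z₀'·ℓ₄(β) + Z_ac'·(−β_yz)] ≥ 0`. [folklore] -/
theorem pairH33_target_nonneg {q : ℝ} (hq1 : q ≤ 1) {β : Biv} (hβ : C3 q β) {s : V5} (hs : s.Nonneg) :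
    0 ≤ pairH33 q β (wedgeH (conv s (edgeBC 0)) (conv s (edgeBC 1))) := by
  obtain ⟨e1, e2, e3, _⟩ := target_blocks s
  rw [pairH33, e1, e2, e3]
  obtain ⟨h0, hab, hac, hbc, h1⟩ := hs
  have hyz := hβ.yz_nonpos (by linarith)
  have h4 := hβ.tgt
  have hzh : 0 ≤ hz s := by simp only [hz]; linarith
  have key : 0 ≤ (2 - q) * (β.uz * (s.z0 * hz s)) - β.yz * (hy s * hz s) := by
    have : (2 - q) * (β.uz * (s.z0 * hz s)) - β.yz * (hy s * hz s) = hz s * (s.z0 * ((2 - q) * β.uz - β.yz) + s.zac * (-β.yz)) := by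
      simp only [hy]; ring
    rw [this]; exact mul_nonneg hzh (add_nonneg (mul_nonneg h0 h4) (mul_nonneg hac (by linarith)))
  have hp : 0 ≤ (1 - q) ^ 2 := sq_nonneg _
  nlinarith [mul_nonneg hp key]

/-- The `∧²V₂`-part of the pairing with a target is non-negative whenever `β_xv ≥ 0` (`q ≤ 1`, masses of `s` non-negative). [folklore] -/
theorem pairH22_target_nonneg {q : ℝ} (hq1 : q ≤ 1) {β : Biv} (hβ : 0 ≤ β.xv) {s : V5} (hs : s.Nonneg) :
    0 ≤ pairH22 q β (wedgeH (conv s (edgeBC 0)) (conv s (edgeBC 1))) := by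
  obtain ⟨_, _, _, e4⟩ := target_blocks s
  rw [pairH22, e4]
  obtain ⟨h0, hab, hac, hbc, h1⟩ := hs
  have : 0 ≤ hx s * s.total := mul_nonneg (by simp only [hx]; linarith) (by simp only [V5.total]; linarith)
  exact mul_nonneg (by linarith) (mul_nonneg hβ this)

/-- **The `∧²V₃`-part of the far cross-apex Rayleigh bivector pairing is non-negative for EVERY middle word** (`0 ≤ q ≤ 1`; input and rest
with non-negative masses; block weights and last rim weight in `[0,1]`). [folklore] -/
theorem pairH33_crossFar_nonneg {q : ℝ} (hq0 : 0 ≤ q) (hq1 : q ≤ 1) {mids : List (ℝ × ℝ × ℝ)} (hm : UnitBlocks mids) {rd : ℝ}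
    (hrd0 : 0 ≤ rd) (hrd1 : rd ≤ 1) {u s : V5} (hu : u.Nonneg) (hs : s.Nonneg) :
    0 ≤ pairH33 q (wedgeH (rimStep q rd (midWord q mids (conv (edgeAC 0) u))) (rimStep q rd (midWord q mids (conv (edgeAC 1) u))))
      (wedgeH (conv s (edgeBC 0)) (conv s (edgeBC 1))) :=
  pairH33_target_nonneg hq1 (C3.midWord hq0 hq1 hm hrd0 hrd1 hu) hs

end ThreeApex

end FK

end Summit.CriticalPhenomena.PercolationContinuityZ3.Theorems
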